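import Summits.QuantumFields.YangMills.Theorems.LuscherReductionTwistedTraceScalingBOCentralRatesFive
import Summits.QuantumFields.YangMills.Theorems.TwistedTraceScaling.Negative.ActionWindowRecord
import HarnessLib

/-!
# (B-O) central tube — RATES, part 7: weighted limits (`× β^{1/5}`) of the factors of the two-sided bound of record (repaired smearing window)

`…BOCentralRatesFive.central_ratio_record` proves `hi₀/lo₀ → 1` with NO rate; the (B-OD) brick needs the relative error `η_c = hi₀/lo₀ − 1`
with `η_c² = o(λ_b(L³β))` (`BOBricks.hb_small`), i.e. `η_c = o(β^{-1/6})`.  We prove the rate `η_c ≤ β^{-1/5}` (next file) by showing that every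
factor `f` of `lo₀/N`, `hi₀/N` satisfies the WEIGHTED limit `(f − 1)·W → 0`, `W(β) = powScale (−1/5) β = max(β,1)^{1/5}`, and every additive tail `t`
satisfies `t·W → 0`.  This file: §1 the algebra of weighted limits (products, inverses, powers, exponentials, tails — weight-generic);
§2 the weight `W = β^{1/5}` and the generic atom lemma (`0 ≤ f ≤ C·β^{-p}ℓ^k`, `p > 1/5` ⇒ `f·W → 0`); §3 the polynomial atoms of schedule B
(`ρ²`, `βρ³`, `βρ⁴`, `C_pδ²`, `882βT²R_in²`, and the REPAIRED smearing exponent `η₀'` with action ceiling `β^{-1/2}`, `O_L(ℓ⁸β^{-1/4})` by cdisprove R53R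
`repaired_recordExponent_le`); §4 the weighted transport defects `ε_q + ε_tr` (both versions).  The tails are part 8.
HONEST FRAMING: rate bookkeeping for (C1); (C4), (C5), (B-ST), C4-CORE OPEN; stub of a child of the CONDITIONAL route R2b1; not a gap, not Clay.
-/

open MeasureTheory Filter Topology Real
open scoped BigOperators
open Literature.MathematicalPhysics.QuantumFieldTheory
open Literature.MathematicalPhysics.QuantumLattice

namespace Summit.QuantumFields.YangMills.Theorems.FemtoTransferGap.TwoLattice.ConstTube

open Summit.QuantumFields.YangMills.Theorems.FemtoTransferGap
open Summit.QuantumFields.YangMills.Theorems.FemtoTransferGap.TwoLattice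
open Summit.QuantumFields.YangMills.Theorems.TwistedTraceScaling.Negative

variable {L : ℕ}

/-! ## §1 The algebra of weighted limits (weight `W` arbitrary) -/

section Algebra

variable {f g t u W : ℝ → ℝ}

/-- Products: `(f−1)W → 0`, `f → 1`, `(g−1)W → 0`, `g → 1` ⇒ the same for `fg`. [folklore] -/
theorem wt_mul (hf : Tendsto (fun β => (f β - 1) * W β) atTop (𝓝 0) ∧ Tendsto f atTop (𝓝 1))
    (hg : Tendsto (fun β => (g β - 1) * W β) atTop (𝓝 0) ∧ Tendsto g atTop (𝓝 1)) :
    Tendsto (fun β => (f β * g β - 1) * W β) atTop (𝓝 0) ∧ Tendsto (fun β => f β * g β) atTop (𝓝 1) := by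
  refine ⟨?_, by simpa using hf.2.mul hg.2⟩
  have h := (hf.1.mul hg.2).add hg.1
  rw [zero_mul, zero_add] at h
  refine h.congr' (Eventually.of_forall fun β => ?_)
  ring

/-- Subtracting a tail: `(f−1)W → 0`, `f → 1`, `tW → 0`, `t → 0` ⇒ the same for `f − t`. [folklore] -/
theorem wt_sub_tail (hf : Tendsto (fun β => (f β - 1) * W β) atTop (𝓝 0) ∧ Tendsto f atTop (𝓝 1))
    (ht : Tendsto (fun β => t β * W β) atTop (𝓝 0) ∧ Tendsto t atTop (𝓝 0)) :
    Tendsto (fun β => (f β - t β - 1) * W β) atTop (𝓝 0) ∧ Tendsto (fun β => f β - t β) atTop (𝓝 1) := by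
  refine ⟨?_, by simpa using hf.2.sub ht.2⟩
  have h := hf.1.sub ht.1
  rw [sub_zero] at h
  refine h.congr' (Eventually.of_forall fun β => ?_)
  ring

/-- Adding a tail. [folklore] -/
theorem wt_add_tail (hf : Tendsto (fun β => (f β - 1) * W β) atTop (𝓝 0) ∧ Tendsto f atTop (𝓝 1))
    (ht : Tendsto (fun β => t β * W β) atTop (𝓝 0) ∧ Tendsto t atTop (𝓝 0)) :
    Tendsto (fun β => (f β + t β - 1) * W β) atTop (𝓝 0) ∧ Tendsto (fun β => f β + t β) atTop (𝓝 1) := by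
  refine ⟨?_, by simpa using hf.2.add ht.2⟩
  have h := hf.1.add ht.1
  rw [add_zero] at h
  refine h.congr' (Eventually.of_forall fun β => ?_)
  ring

/-- A factor times a tail is a tail. [folklore] -/
theorem zt_mul (hf : Tendsto (fun β => (f β - 1) * W β) atTop (𝓝 0) ∧ Tendsto f atTop (𝓝 1))
    (ht : Tendsto (fun β => t β * W β) atTop (𝓝 0) ∧ Tendsto t atTop (𝓝 0)) :
    Tendsto (fun β => f β * t β * W β) atTop (𝓝 0) ∧ Tendsto (fun β => f β * t β) atTop (𝓝 0) := by
  refine ⟨?_, by simpa using hf.2.mul ht.2⟩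
  have h := hf.2.mul ht.1
  rw [one_mul] at h
  refine h.congr' (Eventually.of_forall fun β => ?_)
  ring

/-- The constant factor `1`. [folklore] -/
theorem wt_one : Tendsto (fun β => ((1 : ℝ) - 1) * W β) atTop (𝓝 0) ∧ Tendsto (fun _ : ℝ => (1 : ℝ)) atTop (𝓝 1) :=
  ⟨by simp, tendsto_const_nhds⟩

/-- `1 + t` for a tail `t`. [folklore] -/
theorem wt_one_add (ht : Tendsto (fun β => t β * W β) atTop (𝓝 0) ∧ Tendsto t atTop (𝓝 0)) :
    Tendsto (fun β => (1 + t β - 1) * W β) atTop (𝓝 0) ∧ Tendsto (fun β => 1 + t β) atTop (𝓝 1) := by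
  have h := wt_add_tail (W := W) wt_one ht
  exact h

/-- `1 − t` for a tail `t`. [folklore] -/
theorem wt_one_sub (ht : Tendsto (fun β => t β * W β) atTop (𝓝 0) ∧ Tendsto t atTop (𝓝 0)) :
    Tendsto (fun β => (1 - t β - 1) * W β) atTop (𝓝 0) ∧ Tendsto (fun β => 1 - t β) atTop (𝓝 1) := by
  have h := wt_sub_tail (W := W) wt_one ht
  exact h

/-- Inverses: `(f−1)W → 0`, `f → 1` ⇒ the same for `f⁻¹`. [folklore] -/
theorem wt_inv (hf : Tendsto (fun β => (f β - 1) * W β) atTop (𝓝 0) ∧ Tendsto f atTop (𝓝 1)) :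
    Tendsto (fun β => ((f β)⁻¹ - 1) * W β) atTop (𝓝 0) ∧ Tendsto (fun β => (f β)⁻¹) atTop (𝓝 1) := by
  have hinv : Tendsto (fun β => (f β)⁻¹) atTop (𝓝 1) := by simpa using hf.2.inv₀ one_ne_zero
  refine ⟨?_, hinv⟩
  have h := (hf.1.mul hinv).neg
  rw [zero_mul, neg_zero] at h
  have hne : ∀ᶠ β in atTop, f β ≠ 0 := hf.2.eventually_ne one_ne_zero
  refine h.congr' ?_
  filter_upwards [hne] with β hβ
  field_simp
  ring

/-- Powers. [folklore] -/
theorem wt_pow (hf : Tendsto (fun β => (f β - 1) * W β) atTop (𝓝 0) ∧ Tendsto f atTop (𝓝 1)) (n : ℕ) :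
    Tendsto (fun β => (f β ^ n - 1) * W β) atTop (𝓝 0) ∧ Tendsto (fun β => f β ^ n) atTop (𝓝 1) := by
  induction n with
  | zero => simp
  | succ n ih =>
      have h := wt_mul ih hf
      simpa [pow_succ] using h

/-- Exponentials: `uW → 0`, `u → 0` ⇒ `(e^{u} − 1)W → 0`, `e^{u} → 1` (`|e^{u} − 1| ≤ 2|u|` for `|u| ≤ 1`). [folklore] -/
theorem wt_exp (hu : Tendsto (fun β => u β * W β) atTop (𝓝 0)) (hu0 : Tendsto u atTop (𝓝 0)) :
    Tendsto (fun β => (Real.exp (u β) - 1) * W β) atTop (𝓝 0) ∧ Tendsto (fun β => Real.exp (u β)) atTop (𝓝 1) := by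
  refine ⟨?_, tendsto_exp_one_of_tendsto_zero hu0⟩
  have hsmall : ∀ᶠ β in atTop, |u β| ≤ 1 := by
    have h := hu0.abs
    rw [abs_zero] at h
    exact h.eventually (eventually_le_nhds one_pos)
  have hup : Tendsto (fun β => 2 * ‖u β * W β‖) atTop (𝓝 0) := by simpa using hu.norm.const_mul 2
  refine squeeze_zero_norm' ?_ hup
  filter_upwards [hsmall] with β hβ
  rw [Real.norm_eq_abs, Real.norm_eq_abs, abs_mul, abs_mul]
  have h := Real.abs_exp_sub_one_le hβ
  nlinarith [abs_nonneg (W β), abs_nonneg (u β)]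

/-- Exponentials of `−u`. [folklore] -/
theorem wt_exp_neg (hu : Tendsto (fun β => u β * W β) atTop (𝓝 0)) (hu0 : Tendsto u atTop (𝓝 0)) :
    Tendsto (fun β => (Real.exp (-(u β)) - 1) * W β) atTop (𝓝 0) ∧ Tendsto (fun β => Real.exp (-(u β))) atTop (𝓝 1) := by
  have h1 : Tendsto (fun β => -(u β) * W β) atTop (𝓝 0) := by simpa [neg_mul] using hu.neg
  have h2 : Tendsto (fun β => -(u β)) atTop (𝓝 0) := by simpa using hu0.neg
  exact wt_exp h1 h2

/-- A constant multiple of a tail is a tail. [folklore] -/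
theorem zt_const_mul (c : ℝ) (ht : Tendsto (fun β => t β * W β) atTop (𝓝 0) ∧ Tendsto t atTop (𝓝 0)) :
    Tendsto (fun β => c * t β * W β) atTop (𝓝 0) ∧ Tendsto (fun β => c * t β) atTop (𝓝 0) := by
  refine ⟨?_, by simpa using ht.2.const_mul c⟩
  have h := ht.1.const_mul c
  rw [mul_zero] at h
  refine h.congr' (Eventually.of_forall fun β => ?_)
  ring

/-- The final step: two quantities `a, b` with `(a−1)W, (b−1)W → 0` differ by `o(1/W)`: `(b − a)·W → 0`. [folklore] -/
theorem tendsto_sub_mul_weight (ha : Tendsto (fun β => (f β - 1) * W β) atTop (𝓝 0)) (hb : Tendsto (fun β => (g β - 1) * W β) atTop (𝓝 0)) :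
    Tendsto (fun β => (g β - f β) * W β) atTop (𝓝 0) := by
  have h := hb.sub ha
  rw [sub_zero] at h
  refine h.congr' (Eventually.of_forall fun β => ?_)
  ring

end Algebra

/-! ## §2 The weight `W = max(β,1)^{1/5}` and the generic atom -/

/-- `β^{-p}·W = β^{-(p − 1/5)}`. [folklore] -/
theorem powScale_mul_weight (p β : ℝ) : powScale p β * powScale (-(1 / 5)) β = powScale (p - 1 / 5) β := by
  rw [powScale_mul_powScale]; ring_nf

/-- `0 < W`. [folklore] -/
theorem weight_pos (β : ℝ) : 0 < powScale (-(1 / 5)) β := powScale_pos _ _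

/-- `β^{-1/5}·W = 1`. [folklore] -/
theorem powScale_fifth_mul_weight (β : ℝ) : powScale (1 / 5) β * powScale (-(1 / 5)) β = 1 := by
  rw [powScale_mul_powScale]; norm_num [powScale]

/-- ★ **Generic weighted atom**: `0 ≤ f ≤ C·β^{-p}ℓ^k` eventually with `p > 1/5` ⇒ `f·W → 0` and `f → 0`. [folklore] -/
theorem zt_atom {f : ℝ → ℝ} {C p : ℝ} {k : ℕ} (hp : 1 / 5 < p)
    (h : ∀ᶠ β : ℝ in atTop, 0 ≤ f β ∧ f β ≤ C * (powScale p β * btLog β ^ k)) :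
    Tendsto (fun β => f β * powScale (-(1 / 5)) β) atTop (𝓝 0) ∧ Tendsto f atTop (𝓝 0) := by
  have hp0 : 0 < p := by linarith
  have hup0 : Tendsto (fun β : ℝ => C * (powScale p β * btLog β ^ k)) atTop (𝓝 0) := by
    simpa using (tendsto_powScale_mul_btLog_pow hp0 k).const_mul C
  have hupW : Tendsto (fun β : ℝ => C * (powScale (p - 1 / 5) β * btLog β ^ k)) atTop (𝓝 0) := by
    simpa using (tendsto_powScale_mul_btLog_pow (by linarith : 0 < p - 1 / 5) k).const_mul C
  constructor
  · refine tendsto_of_tendsto_of_tendsto_of_le_of_le' tendsto_const_nhds hupW ?_ ?_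
    · filter_upwards [h] with β hβ
      exact mul_nonneg hβ.1 (weight_pos β).le
    · filter_upwards [h] with β hβ
      calc f β * powScale (-(1 / 5)) β ≤ C * (powScale p β * btLog β ^ k) * powScale (-(1 / 5)) β :=
            mul_le_mul_of_nonneg_right hβ.2 (weight_pos β).le
        _ = C * (powScale (p - 1 / 5) β * btLog β ^ k) := by rw [← powScale_mul_weight]; ring
  · refine tendsto_of_tendsto_of_tendsto_of_le_of_le' tendsto_const_nhds hup0 ?_ ?_
    · filter_upwards [h] with β hβ; exact hβ.1
    · filter_upwards [h] with β hβ; exact hβ.2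

/-! ## §3 The polynomial atoms of schedule B -/

section Atoms

variable [NeZero L]

omit [NeZero L] in
/-- `ρ ≤ 8(45L+1)·β^{-1/2}ℓ²` and `0 ≤ ρ` for `β ≥ 1`. [folklore] -/
theorem schedRho_le {β : ℝ} (hβ : 1 ≤ β) :
    0 ≤ 8 * (9 * (L : ℝ) * (5 * (powScale (1 / 2) β * btLog β ^ 2)) + powScale 1 β) ∧
      8 * (9 * (L : ℝ) * (5 * (powScale (1 / 2) β * btLog β ^ 2)) + powScale 1 β) ≤ 8 * (45 * (L : ℝ) + 1) * (powScale (1 / 2) β * btLog β ^ 2) := by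
  have hT := schedT_le (L := L) hβ
  have hT0 := R52.schedT_nonneg (L := L) β
  constructor
  · positivity
  · linarith

omit [NeZero L] in
/-- Atom `ρ² ≤ 64(45L+1)²·β^{-1}ℓ⁴`: `ρ²·W → 0`. [folklore] -/
theorem zt_rho_sq :
    Tendsto (fun β : ℝ => (8 * (9 * (L : ℝ) * (5 * (powScale (1 / 2) β * btLog β ^ 2)) + powScale 1 β)) ^ 2 * powScale (-(1 / 5)) β) atTop (𝓝 0) ∧
      Tendsto (fun β : ℝ => (8 * (9 * (L : ℝ) * (5 * (powScale (1 / 2) β * btLog β ^ 2)) + powScale 1 β)) ^ 2) atTop (𝓝 0) := by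
  refine zt_atom (C := 64 * (45 * (L : ℝ) + 1) ^ 2) (p := 1) (k := 4) (by norm_num) ?_
  filter_upwards [eventually_ge_atTop (1 : ℝ)] with β hβ
  obtain ⟨hρ0, hρ⟩ := schedRho_le (L := L) hβ
  refine ⟨sq_nonneg _, ?_⟩
  have h1 : powScale (1 / 2) β * powScale (1 / 2) β = powScale 1 β := by rw [powScale_mul_powScale]; norm_num
  calc (8 * (9 * (L : ℝ) * (5 * (powScale (1 / 2) β * btLog β ^ 2)) + powScale 1 β)) ^ 2
      ≤ (8 * (45 * (L : ℝ) + 1) * (powScale (1 / 2) β * btLog β ^ 2)) ^ 2 := pow_le_pow_left₀ hρ0 hρ 2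
    _ = 64 * (45 * (L : ℝ) + 1) ^ 2 * ((powScale (1 / 2) β * powScale (1 / 2) β) * btLog β ^ 4) := by ring
    _ = 64 * (45 * (L : ℝ) + 1) ^ 2 * (powScale 1 β * btLog β ^ 4) := by rw [h1]

omit [NeZero L] in
/-- Atom `βρ³ ≤ 512(45L+1)³·β^{-1/2}ℓ⁶`: `βρ³·W → 0`. [folklore] -/
theorem zt_beta_rho_cube :
    Tendsto (fun β : ℝ => β * (8 * (9 * (L : ℝ) * (5 * (powScale (1 / 2) β * btLog β ^ 2)) + powScale 1 β)) ^ 3 * powScale (-(1 / 5)) β) atTop (𝓝 0) ∧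
      Tendsto (fun β : ℝ => β * (8 * (9 * (L : ℝ) * (5 * (powScale (1 / 2) β * btLog β ^ 2)) + powScale 1 β)) ^ 3) atTop (𝓝 0) := by
  refine zt_atom (C := 512 * (45 * (L : ℝ) + 1) ^ 3) (p := 1 / 2) (k := 6) (by norm_num) ?_
  filter_upwards [eventually_ge_atTop (1 : ℝ)] with β hβ
  obtain ⟨hρ0, hρ⟩ := schedRho_le (L := L) hβ
  have hβ0 : 0 ≤ β := by linarith
  refine ⟨by positivity, ?_⟩
  have h2 : β * powScale (1 / 2) β ^ 2 = 1 := mul_powScale_half_sq hβ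
  calc β * (8 * (9 * (L : ℝ) * (5 * (powScale (1 / 2) β * btLog β ^ 2)) + powScale 1 β)) ^ 3
      ≤ β * (8 * (45 * (L : ℝ) + 1) * (powScale (1 / 2) β * btLog β ^ 2)) ^ 3 := by gcongr
    _ = 512 * (45 * (L : ℝ) + 1) ^ 3 * (powScale (1 / 2) β * btLog β ^ 6) * (β * powScale (1 / 2) β ^ 2) := by ring
    _ = 512 * (45 * (L : ℝ) + 1) ^ 3 * (powScale (1 / 2) β * btLog β ^ 6) := by rw [h2, mul_one]

omit [NeZero L] in
/-- Atom `βρ⁴ ≤ 4096(45L+1)⁴·β^{-1}ℓ⁸`: `βρ⁴·W → 0`. [folklore] -/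
theorem zt_beta_rho_four :
    Tendsto (fun β : ℝ => β * (8 * (9 * (L : ℝ) * (5 * (powScale (1 / 2) β * btLog β ^ 2)) + powScale 1 β)) ^ 4 * powScale (-(1 / 5)) β) atTop (𝓝 0) ∧
      Tendsto (fun β : ℝ => β * (8 * (9 * (L : ℝ) * (5 * (powScale (1 / 2) β * btLog β ^ 2)) + powScale 1 β)) ^ 4) atTop (𝓝 0) := by
  refine zt_atom (C := 4096 * (45 * (L : ℝ) + 1) ^ 4) (p := 1) (k := 8) (by norm_num) ?_
  filter_upwards [eventually_ge_atTop (1 : ℝ)] with β hβ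
  obtain ⟨hρ0, hρ⟩ := schedRho_le (L := L) hβ
  have hβ0 : 0 ≤ β := by linarith
  refine ⟨by positivity, ?_⟩
  have h2 : β * powScale (1 / 2) β ^ 2 = 1 := mul_powScale_half_sq hβ
  have h1 : powScale (1 / 2) β * powScale (1 / 2) β = powScale 1 β := by rw [powScale_mul_powScale]; norm_num
  calc β * (8 * (9 * (L : ℝ) * (5 * (powScale (1 / 2) β * btLog β ^ 2)) + powScale 1 β)) ^ 4
      ≤ β * (8 * (45 * (L : ℝ) + 1) * (powScale (1 / 2) β * btLog β ^ 2)) ^ 4 := by gcongr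
    _ = 4096 * (45 * (L : ℝ) + 1) ^ 4 * ((powScale (1 / 2) β * powScale (1 / 2) β) * btLog β ^ 8) * (β * powScale (1 / 2) β ^ 2) := by ring
    _ = 4096 * (45 * (L : ℝ) + 1) ^ 4 * (powScale 1 β * btLog β ^ 8) := by rw [h2, mul_one, h1]

omit [NeZero L] in
/-- Atom `(P)`: `C·(1·β^{-1/4})²·W → 0` for every real `C`. [folklore] -/
theorem zt_defect (C : ℝ) :
    Tendsto (fun β : ℝ => C * (1 * powScale (1 / 4) β) ^ 2 * powScale (-(1 / 5)) β) atTop (𝓝 0) ∧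
      Tendsto (fun β : ℝ => C * (1 * powScale (1 / 4) β) ^ 2) atTop (𝓝 0) := by
  have hsq : Tendsto (fun β : ℝ => (1 * powScale (1 / 4) β) ^ 2 * powScale (-(1 / 5)) β) atTop (𝓝 0) ∧
      Tendsto (fun β : ℝ => (1 * powScale (1 / 4) β) ^ 2) atTop (𝓝 0) := by
    refine zt_atom (C := 1) (p := 1 / 2) (k := 0) (by norm_num) (Eventually.of_forall fun β => ⟨sq_nonneg _, ?_⟩)
    have h1 : powScale (1 / 4) β * powScale (1 / 4) β = powScale (1 / 2) β := by rw [powScale_mul_powScale]; norm_num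
    rw [one_mul, pow_zero, mul_one, one_mul, sq, h1]
  exact zt_const_mul C hsq

omit [NeZero L] in
/-- Atom `882βT²R_in² ≤ (882/144)(45L+1)²·β^{-1}ℓ⁶` (`R_in = r_f/12`, `r_f ≤ β^{-1/2}ℓ`): `·W → 0`. [folklore] -/
theorem zt_loc :
    Tendsto (fun β : ℝ => 882 * β * (9 * (L : ℝ) * (5 * (powScale (1 / 2) β * btLog β ^ 2)) + powScale 1 β) ^ 2 *
        (min (1 / 40) (powScale (1 / 2) β * btLog β) / 12) ^ 2 * powScale (-(1 / 5)) β) atTop (𝓝 0) ∧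
      Tendsto (fun β : ℝ => 882 * β * (9 * (L : ℝ) * (5 * (powScale (1 / 2) β * btLog β ^ 2)) + powScale 1 β) ^ 2 *
        (min (1 / 40) (powScale (1 / 2) β * btLog β) / 12) ^ 2) atTop (𝓝 0) := by
  refine zt_atom (C := 882 / 144 * (45 * (L : ℝ) + 1) ^ 2) (p := 1) (k := 6) (by norm_num) ?_
  filter_upwards [eventually_ge_atTop (1 : ℝ)] with β hβ
  have hβ0 : 0 ≤ β := by linarith
  have hβT := R52.beta_schedT_sq_le (L := L) hβ
  have hℓ := one_le_btLog β
  have hx := (powScale_pos (1 / 2) β).le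
  have hmin0 : 0 ≤ min (1 / 40) (powScale (1 / 2) β * btLog β) := le_min (by norm_num) (by positivity)
  refine ⟨by positivity, ?_⟩
  have hm : (min (1 / 40) (powScale (1 / 2) β * btLog β) / 12) ^ 2 ≤ (powScale (1 / 2) β * btLog β / 12) ^ 2 := by
    gcongr; exact min_le_right _ _
  have h1 : powScale (1 / 2) β * powScale (1 / 2) β = powScale 1 β := by rw [powScale_mul_powScale]; norm_num
  have hT2 : 0 ≤ β * (9 * (L : ℝ) * (5 * (powScale (1 / 2) β * btLog β ^ 2)) + powScale 1 β) ^ 2 := by positivity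
  calc 882 * β * (9 * (L : ℝ) * (5 * (powScale (1 / 2) β * btLog β ^ 2)) + powScale 1 β) ^ 2 * (min (1 / 40) (powScale (1 / 2) β * btLog β) / 12) ^ 2
      = 882 * (β * (9 * (L : ℝ) * (5 * (powScale (1 / 2) β * btLog β ^ 2)) + powScale 1 β) ^ 2) * (min (1 / 40) (powScale (1 / 2) β * btLog β) / 12) ^ 2 := by ring
    _ ≤ 882 * ((45 * (L : ℝ) + 1) ^ 2 * btLog β ^ 4) * (powScale (1 / 2) β * btLog β / 12) ^ 2 := by gcongr
    _ = 882 / 144 * (45 * (L : ℝ) + 1) ^ 2 * ((powScale (1 / 2) β * powScale (1 / 2) β) * btLog β ^ 6) := by ring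
    _ = 882 / 144 * (45 * (L : ℝ) + 1) ^ 2 * (powScale 1 β * btLog β ^ 6) := by rw [h1]

/-- ★ Atom of the REPAIRED smearing window (action ceiling `β^{-1/2}`): the exponent `η₀' = O_L(ℓ⁸β^{-1/4})` (cdisprove R53R) has `η₀'·W → 0`. [folklore] -/
theorem zt_smearing :
    Tendsto (fun β : ℝ => (coreEta L β 0 (powScale (1 / 3) β) (9 * (L : ℝ) * (5 * (powScale (1 / 2) β * btLog β ^ 2)) + (powScale 1 β)) (min (1 / 40) (powScale (1 / 2) β * btLog β)) ((powScale 1 β) * Fintype.card (Site 3 L)) (powScale (1 / 2) β) + coreEps1 L β 0 (9 * (L : ℝ) * (5 * (powScale (1 / 2) β * btLog β ^ 2)) + (powScale 1 β)) (min (1 / 40) (powScale (1 / 2) β * btLog β)) + coreEps2 L β 0 (9 * (L : ℝ) * (5 * (powScale (1 / 2) β * btLog β ^ 2)) + (powScale 1 β)) (min (1 / 40) (powScale (1 / 2) β * btLog β)) (powScale (1 / 2) β)) * powScale (-(1 / 5)) β) atTop (𝓝 0) ∧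
      Tendsto (fun β : ℝ => coreEta L β 0 (powScale (1 / 3) β) (9 * (L : ℝ) * (5 * (powScale (1 / 2) β * btLog β ^ 2)) + (powScale 1 β)) (min (1 / 40) (powScale (1 / 2) β * btLog β)) ((powScale 1 β) * Fintype.card (Site 3 L)) (powScale (1 / 2) β) + coreEps1 L β 0 (9 * (L : ℝ) * (5 * (powScale (1 / 2) β * btLog β ^ 2)) + (powScale 1 β)) (min (1 / 40) (powScale (1 / 2) β * btLog β)) + coreEps2 L β 0 (9 * (L : ℝ) * (5 * (powScale (1 / 2) β * btLog β ^ 2)) + (powScale 1 β)) (min (1 / 40) (powScale (1 / 2) β * btLog β)) (powScale (1 / 2) β)) atTop (𝓝 0) := by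
  refine zt_atom (C := (45 * (L : ℝ) + 1) ^ 4 * (750 * (Fintype.card (Edge 3 L) : ℝ) + 5140 * (Fintype.card (Plaquette 3 L × Fin 3) : ℝ) + 2193291 * (Fintype.card (Plaquette 3 L) : ℝ)))
    (p := 1 / 4) (k := 8) (by norm_num) ?_
  filter_upwards [eventually_ge_atTop (1 : ℝ)] with β hβ
  have hβ0 : 0 ≤ β := by linarith
  refine ⟨R53R.recordExponent_nonneg (L := L) hβ0 (powScale_pos _ _).le, ?_⟩
  have h := R53R.repaired_recordExponent_le (L := L) hβ
  calc _ ≤ (45 * (L : ℝ) + 1) ^ 4 * btLog β ^ 8 * powScale (1 / 4) β *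
        (750 * (Fintype.card (Edge 3 L) : ℝ) + 5140 * (Fintype.card (Plaquette 3 L × Fin 3) : ℝ) + 2193291 * (Fintype.card (Plaquette 3 L) : ℝ)) := h
    _ = _ := by ring

end Atoms

/-! ## §4 The weighted transport defects `ε_q + ε_tr` -/

/-- **Abstract weighted vanishing of the transport defects**: if `r, ρ → 0` and the weighted atoms `β·r·ρ·W, β·r²·W, β·r·r_f·W, β·ρ²·r_f·W, β·ρ³·W, β·ρ⁴·W`
tend to `0`, then so do both exponents `ε_q + ε_tr` times `W` (every monomial contains exactly one atom). [folklore] -/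
theorem tendsto_transport_defect_abstract_weighted {r ρ rf W : ℝ → ℝ} (hr : Tendsto r atTop (𝓝 0)) (hρ : Tendsto ρ atTop (𝓝 0))
    (h1 : Tendsto (fun β => β * r β * ρ β * W β) atTop (𝓝 0)) (h2 : Tendsto (fun β => β * r β ^ 2 * W β) atTop (𝓝 0))
    (h3 : Tendsto (fun β => β * r β * rf β * W β) atTop (𝓝 0)) (h4 : Tendsto (fun β => β * ρ β ^ 2 * rf β * W β) atTop (𝓝 0))
    (h5 : Tendsto (fun β => β * ρ β ^ 3 * W β) atTop (𝓝 0)) (h6 : Tendsto (fun β => β * ρ β ^ 4 * W β) atTop (𝓝 0)) (B MT CL Ksp E sE : ℝ) :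
    Tendsto (fun β : ℝ => (((96 * (β / 2) + (β)) * (B * r β + MT * r β ^ 2) * (2 * (((rf β / 12) + (9 / 10 * rf β)) + 14 * E * ρ β ^ 2 + (CL * ((4 + 48 * Ksp) * ρ β) * (9 * Ksp * ρ β) + MT * (9 * Ksp * ρ β) ^ 2)) + (B * r β + MT * r β ^ 2))) + ((96 * (β / 2) + (β)) * ((CL * ((4 + 48 * Ksp) * ρ β) * (9 * Ksp * ρ β) + MT * (9 * Ksp * ρ β) ^ 2) * (2 * (((rf β / 12) + (9 / 10 * rf β)) + 14 * E * ρ β ^ 2 + (CL * ((4 + 48 * Ksp) * ρ β) * (9 * Ksp * ρ β) + MT * (9 * Ksp * ρ β) ^ 2)) + (CL * ((4 + 48 * Ksp) * ρ β) * (9 * Ksp * ρ β) + MT * (9 * Ksp * ρ β) ^ 2)) + 72 * E * ρ β ^ 3))) * W β) atTop (𝓝 0) ∧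
      Tendsto (fun β : ℝ => (((96 * (β / 2) + (β)) * (B * r β + MT * r β ^ 2) * (2 * (sE * ρ β + (7 * E * ρ β + B * (9 * Ksp * ρ β) + MT * (9 * Ksp * ρ β) ^ 2)) + (B * r β + MT * r β ^ 2))) + ((96 * (β / 2) + (β)) * ((CL * ((4 + 48 * Ksp) * ρ β) * (9 * Ksp * ρ β) + MT * (9 * Ksp * ρ β) ^ 2) * (2 * (sE * ρ β + (7 * E * ρ β + B * (9 * Ksp * ρ β) + MT * (9 * Ksp * ρ β) ^ 2)) + (CL * ((4 + 48 * Ksp) * ρ β) * (9 * Ksp * ρ β) + MT * (9 * Ksp * ρ β) ^ 2)) + 72 * E * ρ β ^ 3))) * W β) atTop (𝓝 0) := by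
  set κ : ℝ := CL * (4 + 48 * Ksp) * (9 * Ksp) + MT * (81 * Ksp ^ 2) with hκ
  have T1 : Tendsto (fun β => B + MT * r β) atTop (𝓝 (B + MT * 0)) := tendsto_const_nhds.add (hr.const_mul MT)
  constructor
  · have hlo := (((T1.mul ((((h3.const_mul (59 / 30)).add ((h1.mul hρ).const_mul (28 * E))).add ((h1.mul hρ).const_mul (2 * κ))).add
        (h2.mul T1))).add ((((h4.const_mul (59 / 30)).add (h6.const_mul (28 * E))).add (h6.const_mul (3 * κ))).const_mul κ)).add
        (h5.const_mul (72 * E))).const_mul 49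
    simp only [mul_zero, add_zero, zero_mul] at hlo
    refine hlo.congr' (Eventually.of_forall fun β => ?_)
    simp only [hκ]
    ring
  · have hhi := (((T1.mul ((((h1.const_mul (2 * sE + 14 * E + 18 * B * Ksp)).add ((h1.mul hρ).const_mul (162 * MT * Ksp ^ 2)))).add
        (h2.mul T1))).add ((((h5.const_mul (2 * sE + 14 * E + 18 * B * Ksp)).add (h6.const_mul (162 * MT * Ksp ^ 2))).add
        (h6.const_mul κ)).const_mul κ)).add (h5.const_mul (72 * E))).const_mul 49
    simp only [mul_zero, add_zero, zero_mul] at hhi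
    refine hhi.congr' (Eventually.of_forall fun β => ?_)
    simp only [hκ]
    ring

/-- ★ **The weighted transport defects vanish on schedule B**: both exponents `ε_q + ε_tr` of `central_transfer_record(_two)` times `W = β^{1/5}`
tend to `0`, for all real `B, M_T, C_L, K_sp`. [folklore] -/
theorem zt_transport_defects [NeZero L] (Ksp MT B CL : ℝ) :
    Tendsto (fun β : ℝ => (((96 * (β / 2) + (β)) * (B * (powScale 1 β * btLog β ^ 3) + MT * (powScale 1 β * btLog β ^ 3) ^ 2) * (2 * ((((min (1 / 40) (powScale (1 / 2) β * btLog β)) / 12) + (9 / 10 * (min (1 / 40) (powScale (1 / 2) β * btLog β)))) + 14 * ((Fintype.card (Edge 3 L) : ℝ)) * (8 * (9 * (L : ℝ) * (5 * (powScale (1 / 2) β * btLog β ^ 2)) + (powScale 1 β))) ^ 2 + (CL * ((4 + 48 * Ksp) * (8 * (9 * (L : ℝ) * (5 * (powScale (1 / 2) β * btLog β ^ 2)) + (powScale 1 β)))) * (9 * Ksp * (8 * (9 * (L : ℝ) * (5 * (powScale (1 / 2) β * btLog β ^ 2)) + (powScale 1 β)))) + MT * (9 * Ksp * (8 * (9 *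 (L : ℝ) * (5 * (powScale (1 / 2) β * btLog β ^ 2)) + (powScale 1 β)))) ^ 2)) + (B * (powScale 1 β * btLog β ^ 3) + MT * (powScale 1 β * btLog β ^ 3) ^ 2))) + ((96 * (β / 2) + (β)) * ((CL * ((4 + 48 * Ksp) * (8 * (9 * (L : ℝ) * (5 * (powScale (1 / 2) β * btLog β ^ 2)) + (powScale 1 β)))) * (9 * Ksp * (8 * (9 * (L : ℝ) * (5 * (powScale (1 / 2) β * btLog β ^ 2)) + (powScale 1 β)))) + MT * (9 * Ksp * (8 * (9 * (L : ℝ) * (5 * (powScale (1 / 2) β * btLog β ^ 2)) + (powScale 1 β)))) ^ 2) * (2 * ((((min (1 / 40) (powScale (1 / 2) β * btLog β)) / 12) + (9 / 10 * (min (1 / 40) (powScale (1 / 2) β * btLog β)))) + 14 * ((Fintype.card (Edge 3 L) : ℝ)) * (8 * (9 * (L : ℝ) * (5 * (powScale (1 / 2) β * btLog β ^ 2)) + (powScale 1 β))) ^ 2 + (CL * ((4 + 48 * Ksp) * (8 * (9 * (L : ℝ) * (5 * (powScale (1 / 2) β * btLog β ^ 2)) + (powScale 1 β)))) * (9 * Ksp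 * (8 * (9 * (L : ℝ) * (5 * (powScale (1 / 2) β * btLog β ^ 2)) + (powScale 1 β)))) + MT * (9 * Ksp * (8 * (9 * (L : ℝ) * (5 * (powScale (1 / 2) β * btLog β ^ 2)) + (powScale 1 β)))) ^ 2)) + (CL * ((4 + 48 * Ksp) * (8 * (9 * (L : ℝ) * (5 * (powScale (1 / 2) β * btLog β ^ 2)) + (powScale 1 β)))) * (9 * Ksp * (8 * (9 * (L : ℝ) * (5 * (powScale (1 / 2) β * btLog β ^ 2)) + (powScale 1 β)))) + MT * (9 * Ksp * (8 * (9 * (L : ℝ) * (5 * (powScale (1 / 2) β * btLog β ^ 2)) + (powScale 1 β)))) ^ 2)) + 72 * ((Fintype.card (Edge 3 L) : ℝ)) * (8 * (9 * (L : ℝ) * (5 * (powScale (1 / 2) β * btLog β ^ 2)) + (powScale 1 β))) ^ 3))) * powScale (-(1 / 5)) β) atTop (𝓝 0) ∧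
      Tendsto (fun β : ℝ => (((96 * (β / 2) + (β)) * (B * (powScale 1 β * btLog β ^ 3) + MT * (powScale 1 β * btLog β ^ 3) ^ 2) * (2 * (Real.sqrt ((Fintype.card (Edge 3 L) : ℝ)) * (8 * (9 * (L : ℝ) * (5 * (powScale (1 / 2) β * btLog β ^ 2)) + (powScale 1 β))) + (7 * ((Fintype.card (Edge 3 L) : ℝ)) * (8 * (9 * (L : ℝ) * (5 * (powScale (1 / 2) β * btLog β ^ 2)) + (powScale 1 β))) + B * (9 * Ksp * (8 * (9 * (L : ℝ) * (5 * (powScale (1 / 2) β * btLog β ^ 2)) + (powScale 1 β)))) + MT * (9 * Ksp * (8 * (9 * (L : ℝ) * (5 * (powScale (1 / 2) β * btLog β ^ 2)) + (powScale 1 β)))) ^ 2)) + (B * (powScale 1 β * btLog β ^ 3) + MT * (powScale 1 β * btLog β ^ 3) ^ 2))) + ((96 * (β / 2) + (β)) * ((CL * ((4 + 48 * Ksp) * (8 * (9 * (L : ℝ) * (5 * (powScale (1 / 2) β * btLog β ^ 2)) + (powScale 1 β)))) * (9 * Ksp * (8 * (9 * (L : ℝ) * (5 * (powScale (1 / 2)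 β * btLog β ^ 2)) + (powScale 1 β)))) + MT * (9 * Ksp * (8 * (9 * (L : ℝ) * (5 * (powScale (1 / 2) β * btLog β ^ 2)) + (powScale 1 β)))) ^ 2) * (2 * (Real.sqrt ((Fintype.card (Edge 3 L) : ℝ)) * (8 * (9 * (L : ℝ) * (5 * (powScale (1 / 2) β * btLog β ^ 2)) + (powScale 1 β))) + (7 * ((Fintype.card (Edge 3 L) : ℝ)) * (8 * (9 * (L : ℝ) * (5 * (powScale (1 / 2) β * btLog β ^ 2)) + (powScale 1 β))) + B * (9 * Ksp * (8 * (9 * (L : ℝ) * (5 * (powScale (1 / 2) β * btLog β ^ 2)) + (powScale 1 β)))) + MT * (9 * Ksp * (8 * (9 * (L : ℝ) * (5 * (powScale (1 / 2) β * btLog β ^ 2)) + (powScale 1 β)))) ^ 2)) + (CL * ((4 + 48 * Ksp) * (8 * (9 * (L : ℝ) * (5 * (powScale (1 / 2) β * btLog β ^ 2)) + (powScale 1 β)))) * (9 * Ksp * (8 * (9 * (L : ℝ) * (5 * (powScale (1 / 2) β * btLog β ^ 2)) + (powScale 1 β)))) + MT * (9 * Ksp * (8 * (9 * (L : ℝ)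 * (5 * (powScale (1 / 2) β * btLog β ^ 2)) + (powScale 1 β)))) ^ 2)) + 72 * ((Fintype.card (Edge 3 L) : ℝ)) * (8 * (9 * (L : ℝ) * (5 * (powScale (1 / 2) β * btLog β ^ 2)) + (powScale 1 β))) ^ 3))) * powScale (-(1 / 5)) β) atTop (𝓝 0) := by
  -- the six weighted atoms on schedule B
  have hr0 : ∀ β : ℝ, 1 ≤ β → β * (powScale 1 β * btLog β ^ 3) = btLog β ^ 3 := fun β hβ => by
    rw [← mul_assoc, mul_powScale_one hβ, one_mul]
  have h1 : Tendsto (fun β : ℝ => β * (powScale 1 β * btLog β ^ 3) * (8 * (9 * (L : ℝ) * (5 * (powScale (1 / 2) β * btLog β ^ 2)) + powScale 1 β)) * powScale (-(1 / 5)) β) atTop (𝓝 0) := by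
    refine (zt_atom (C := 8 * (45 * (L : ℝ) + 1)) (p := 1 / 2) (k := 5) (by norm_num) ?_).1
    filter_upwards [eventually_ge_atTop (1 : ℝ)] with β hβ
    obtain ⟨hρ0, hρ⟩ := schedRho_le (L := L) hβ
    have hℓ : 0 ≤ btLog β := le_trans zero_le_one (one_le_btLog β)
    rw [hr0 β hβ]
    refine ⟨by positivity, ?_⟩
    calc btLog β ^ 3 * (8 * (9 * (L : ℝ) * (5 * (powScale (1 / 2) β * btLog β ^ 2)) + powScale 1 β)) ≤ btLog β ^ 3 * (8 * (45 * (L : ℝ) + 1) * (powScale (1 / 2) β * btLog β ^ 2)) :=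
          mul_le_mul_of_nonneg_left hρ (by positivity)
      _ = 8 * (45 * (L : ℝ) + 1) * (powScale (1 / 2) β * btLog β ^ 5) := by ring
  have h2 : Tendsto (fun β : ℝ => β * (powScale 1 β * btLog β ^ 3) ^ 2 * powScale (-(1 / 5)) β) atTop (𝓝 0) := by
    refine (zt_atom (C := 1) (p := 1) (k := 6) (by norm_num) ?_).1
    filter_upwards [eventually_ge_atTop (1 : ℝ)] with β hβ
    have hℓ : 0 ≤ btLog β := le_trans zero_le_one (one_le_btLog β)
    have hβ0 : 0 ≤ β := by linarith
    have h10 := (powScale_pos 1 β).le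
    refine ⟨by positivity, le_of_eq ?_⟩
    calc β * (powScale 1 β * btLog β ^ 3) ^ 2 = (β * (powScale 1 β * btLog β ^ 3)) * (powScale 1 β * btLog β ^ 3) := by ring
      _ = 1 * (powScale 1 β * btLog β ^ 6) := by rw [hr0 β hβ]; ring
  have h3 : Tendsto (fun β : ℝ => β * (powScale 1 β * btLog β ^ 3) * min (1 / 40) (powScale (1 / 2) β * btLog β) * powScale (-(1 / 5)) β) atTop (𝓝 0) := by
    refine (zt_atom (C := 1) (p := 1 / 2) (k := 4) (by norm_num) ?_).1
    filter_upwards [eventually_ge_atTop (1 : ℝ)] with β hβ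
    have hℓ : 0 ≤ btLog β := le_trans zero_le_one (one_le_btLog β)
    have hx := (powScale_pos (1 / 2) β).le
    have hmin0 : 0 ≤ min (1 / 40) (powScale (1 / 2) β * btLog β) := le_min (by norm_num) (by positivity)
    rw [hr0 β hβ]
    refine ⟨by positivity, ?_⟩
    calc btLog β ^ 3 * min (1 / 40) (powScale (1 / 2) β * btLog β) ≤ btLog β ^ 3 * (powScale (1 / 2) β * btLog β) :=
          mul_le_mul_of_nonneg_left (min_le_right _ _) (by positivity)
      _ = 1 * (powScale (1 / 2) β * btLog β ^ 4) := by ring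
  have h4 : Tendsto (fun β : ℝ => β * (8 * (9 * (L : ℝ) * (5 * (powScale (1 / 2) β * btLog β ^ 2)) + powScale 1 β)) ^ 2 *
      min (1 / 40) (powScale (1 / 2) β * btLog β) * powScale (-(1 / 5)) β) atTop (𝓝 0) := by
    refine (zt_atom (C := 64 * (45 * (L : ℝ) + 1) ^ 2) (p := 1 / 2) (k := 5) (by norm_num) ?_).1
    filter_upwards [eventually_ge_atTop (1 : ℝ)] with β hβ
    obtain ⟨hρ0, hρ⟩ := schedRho_le (L := L) hβ
    have hℓ : 0 ≤ btLog β := le_trans zero_le_one (one_le_btLog β)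
    have hx := (powScale_pos (1 / 2) β).le
    have hβ0 : 0 ≤ β := by linarith
    have hmin0 : 0 ≤ min (1 / 40) (powScale (1 / 2) β * btLog β) := le_min (by norm_num) (by positivity)
    have h2' : β * powScale (1 / 2) β ^ 2 = 1 := mul_powScale_half_sq hβ
    refine ⟨by positivity, ?_⟩
    calc β * (8 * (9 * (L : ℝ) * (5 * (powScale (1 / 2) β * btLog β ^ 2)) + powScale 1 β)) ^ 2 * min (1 / 40) (powScale (1 / 2) β * btLog β)
        ≤ β * (8 * (45 * (L : ℝ) + 1) * (powScale (1 / 2) β * btLog β ^ 2)) ^ 2 * (powScale (1 / 2) β * btLog β) := by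
          gcongr; exact min_le_right _ _
      _ = 64 * (45 * (L : ℝ) + 1) ^ 2 * (powScale (1 / 2) β * btLog β ^ 5) * (β * powScale (1 / 2) β ^ 2) := by ring
      _ = 64 * (45 * (L : ℝ) + 1) ^ 2 * (powScale (1 / 2) β * btLog β ^ 5) := by rw [h2', mul_one]
  exact tendsto_transport_defect_abstract_weighted (r := fun β => powScale 1 β * btLog β ^ 3)
    (ρ := fun β => 8 * (9 * (L : ℝ) * (5 * (powScale (1 / 2) β * btLog β ^ 2)) + powScale 1 β))
    (rf := fun β => min (1 / 40) (powScale (1 / 2) β * btLog β)) (W := fun β => powScale (-(1 / 5)) β) tendsto_schedCore tendsto_schedRho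
    h1 h2 h3 h4 (zt_beta_rho_cube (L := L)).1 (zt_beta_rho_four (L := L)).1 B MT CL Ksp ((Fintype.card (Edge 3 L) : ℝ)) (Real.sqrt ((Fintype.card (Edge 3 L) : ℝ)))

end Summit.QuantumFields.YangMills.Theorems.FemtoTransferGap.TwoLattice.ConstTube
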